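import Summits.BirchSwinnertonDyer.BirchSwinnertonDyer.Theorems.SchneiderFreeAdditiveX3AnomalousTwistLambdaLEOffP
import Summits.BirchSwinnertonDyer.BirchSwinnertonDyer.Theorems.SchneiderFreeAdditiveX3AnomalousTwistOrientation
import Summits.BirchSwinnertonDyer.BirchSwinnertonDyer.Theorems.SchneiderFreeAdditiveX3LocalTowerTorsionFiniteX3
import Summits.BirchSwinnertonDyer.BirchSwinnertonDyer.Theorems.SchneiderFreeAdditiveX3AnticycControlAdditiveStubNoLocalPTorsionOfAtoms
import HarnessLib

/-!
# Route `SchneiderFreeAdditiveX3` (K1 door), crux r3 `GordTwoBranchIMC` (stmt-BirchSwinnertonDyer-19177): **KELLER–YIN'S ANOMALOUS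
# λ-INEQUALITY ON THE (G-ord, `e = 2`) CELL OF B6 ∩ X3 AT `p = 3`, ANOMALOUS TWIST CLASS, IN THE DOOR's CURRENCY — every displayed
# binder of FILES 3–7 (orientation, `W(K)[3] = 0`, Fin_v) DISCHARGED; what remains displayed is the cell, the anomalous twist model,
# Keller–Yin's lattice normalisation and `r_an = 1`**

Cell `bsd-schneider-ideate`, seat `bsd-schneider-door-c5` (prover, generation 31; assembly layer; `--supports` 19177, helper).
PARTITION: board row B6 ∩ X3 ∩ sst-twist, `r = 1` — the 1 725 ANOMALOUS pairs of the (G-ord, `e = 2`) half at `p = 3` (of 2 411; census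
kit j319291 cross-tab, j323864 «kynorm3»: a KY-normalised member exists on 1 725 / 1 725 classes).  bears_on: K1-door (items 18971/18972
retired → 19177 r3).  FILE 9 (last) of the port of cell `bsd-eis`'s V21 INDEX ROAD (Keller–Yin arXiv:2402.12781 Thm. 1.4.1 (iii), kernel modulo
published facts for the GOOD anomalous lattice, x1 LEAD g4 2026-08-28) to the door's ANOMALOUS TWIN = FINDING-door-c5-g28 §5b's `stub_λW`
(«the twist's own λ-count with the +1 — NOT in print, NOT typable as Literature; kernel derivation = bsd-eis A7 transported»).

`lambdaInvariant_add_le_three_of_anomalousTwist_of_normalised`.  DATA: `W/ℚ` globally minimal on the cell (`ClassX3 W 3`, `SubGordTwo W 3`)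
with `r_an(W) = 1`; an ANOMALOUS good-ordinary `(−3)`-twist model `W = C • V^{(3*)}`, `V` globally minimal, `GoodOrd V 3`, `3 ∣ a₃(V) − 1`
(one exists iff the class is anomalous: generation 25's `ClassX3Gord.exists_goodOrd_pStar_twist_model`, generation 28 §2c); Keller–Yin's
lattice normalisation «every rational `3`-line of `W` is `D₃`-non-trivial» (`hnorm`; arXiv:2410.23241 §3.3 — the member `W₁` of FINDING-door-c5-g28's
lattice remark); `K` imaginary quadratic with (Heeg) for `N_W` (so `3 = v v̄` splits), `v` through `ι : K →+* ℚ₃`, `v̄ ≠ v`; `κ` anticyclotomic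
with topological generator `γ`; `(θsub, θquot)` ANY residual pair of `W_K[3]` (`KellerYin2024.IsResidualPairOver`); `Sf` the `3`-free places over
`N_W`; dual data `DSsub`, `DSquot` of `H¹_{𝓕_nr^{Sf}}(K_∞, (F/𝒪)(θ))`; the cotorsion clauses («`𝔛^{Sf}(W_K)` f.g. `Λ`-torsion, `μ = 0`» =
the door's [INV.μ]/[DIV.tors], generation 28's `AnomalousTwistMuZero`; «every dual datum of each character f.g. torsion `μ = 0`» = [RH]/[PWL-θ]
through KY Prop. 1.2.5).  CONCLUSION: `λ(DSsub.X) + λ(DSquot.X) ≤ λ(𝔛^{Sf}(W_K)) + [θquot = 𝟙]`, GRANTED BY NAME the six PUBLISHED facts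
Greenberg 2016 Prop. 2.6.3, Greenberg 2006 Props. 4.1, 4.2, §5 A, 3.2, NSW (8.3.18) `cd_3(G_{K,Σ}) ≤ 2`.
DISCHARGES (all kernel theorems): orientation `θsub|_{D_v̄} ≠ 𝟙` for EVERY residual pair and `W(K)[3] = 0` (FILE 8b, from `hnorm`); Fin_v
`W(K_{∞,v̄})[3^∞]` finite (the door's CLOSED crux r5 `localTowerTorsionFiniteX3_proof`, 19546 — the one place `r_an = 1` is used); `3` split in `K`
(`splitsIn_of_satisfiesHeegnerHypothesis`).

HONEST FRAMING: composition theorem CONDITIONAL BY NAME on six published facts typed as `Prop`s (not proved in the tree); the cotorsion clauses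
are HYPOTHESES (their door suppliers, generation 28's F14/F15, are conditional on bsd-eis's typed [RH]/[PWL-θ]); nothing analytic (no `𝓛`, no
congruence, no main conjecture) is touched — for the anomalous sub-cell the analytic inputs [AN3-anom] (KY Thm 2.2.2 with partial descent, PRE)
and [BR] for the `{𝟙̃, ω̃}` / `{χ̃, ω̃χ̃}` branches remain exactly as in FINDING-door-c5-g28 §5b; no registered stub of 19177's skeleton v10b is
closed (all six are named facts); no item closed; BSD proved for no curve; «closes rung: none».
References: Keller–Yin arXiv:2402.12781v2 Thm. 1.4.1 (iii), §1.3–§1.4; arXiv:2410.23241 §3.3 [KellerYin2024]; [Greenberg2016Selmer] Prop. 2.6.3;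
[Greenberg2006] Props. 3.2, 4.1, 4.2, §5 A; [NeukirchSchmidtWingberg2008] (8.3.18); [JetchevSkinnerWan2017] Prop. 3.3.4 (Fin_v).
-/

set_option autoImplicit false
-- the route's Theorems namespace repeats the summit name by design (D-0017 nested layout)
set_option linter.dupNamespace false

noncomputable section

open scoped Classical

namespace Summit.BirchSwinnertonDyer.BirchSwinnertonDyer.Theorems.SchneiderFreeAdditiveX3.AnomalousTwistLambdaLEDoor

open PowerSeries WeierstrassCurve NumberField IsDedekindDomain Field
  Literature.NumberTheory.GaloisRepresentations Literature.NumberTheory.EllipticCurves.GreenbergVatsal2000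
  Literature.NumberTheory.EllipticCurves Literature.NumberTheory.EllipticCurves.Rank1Residual
  Literature.NumberTheory.EllipticCurves.Castella2018 Literature.NumberTheory.EllipticCurves.GreenbergSelmer
  Literature.NumberTheory.QuadraticFields Literature.NumberTheory.EllipticCurves.KellerYin2024
  Literature.NumberTheory.EllipticCurves.IwasawaAlgebra Literature.NumberTheory.IwasawaTheory
  Literature.NumberTheory.IwasawaTheory.Greenberg2016 Literature.NumberTheory.IwasawaTheory.Greenberg2006
  Literature.NumberTheory.GaloisCohomology
  Summit.BirchSwinnertonDyer.Rank1Residual Summit.BirchSwinnertonDyer.Rank1Residual.Additive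
  Summit.BirchSwinnertonDyer.Rank1Residual.X2.ResidualDevissageModules
  Summit.BirchSwinnertonDyer.BirchSwinnertonDyer.Theorems
  Summit.BirchSwinnertonDyer.BirchSwinnertonDyer.Theorems.SchneiderFreeAdditiveX3

/-- **Keller–Yin's anomalous `λ`-inequality (Thm. 1.4.1 (iii), `≤` half) ON THE (G-ord, `e = 2`) CELL OF B6 ∩ X3 AT `p = 3`, anomalous twist
class, Keller–Yin-normalised member, in the door's currency** — see the module docstring.  `W(K)[3] = 0`, the orientation and Fin_v are
DISCHARGED; the six published facts are named antecedents; the cotorsion clauses are hypotheses.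
[cite: KellerYin2024, Thm. 1.4.1 (iii) and §1.3–§1.4 Cases I–III (arXiv:2402.12781v2 TeX L1087–1330); arXiv:2410.23241 §3.3]
[cite: Greenberg2016Selmer, Prop. 2.6.3] [cite: Greenberg2006, Props. 3.2, 4.1, 4.2, §5 A] [cite: NeukirchSchmidtWingberg2008, (8.3.18)]
[cite: JetchevSkinnerWan2017, §3.3 Prop. 3.3.4 Case 3(b) (arXiv:1512.06894 p. 13)] -/
theorem lambdaInvariant_add_le_three_of_anomalousTwist_of_normalised
    (h263 : prop263_sur_of_crk) (h41 : prop41_globalEulerPoincareCorank)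
    (h42 : prop42_localEulerPoincareCorank) (h5A : sec5A_localH2_subsingleton_of_LOC1)
    (h32 : prop32_cohomology_isCofinitelyGenerated)
    (W : WeierstrassCurve ℚ) [W.IsElliptic] [W.IsGloballyMinimal]
    (hr : W.analyticRank = 1) (hX : ClassX3 W 3) (hSG : SubGordTwo W 3)
    {V : WeierstrassCurve ℚ} [V.IsElliptic] [V.IsGloballyMinimal] (hV : GoodOrd V 3) (ha : (3 : ℤ) ∣ V.frobeniusTrace 3 - 1)
    (C : VariableChange ℚ) (hC : C • V.quadraticTwist ((-1 : ℚ) ^ ((3 : ℕ) / 2) * ((3 : ℕ) : ℚ)) = W)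
    (hnorm : ∀ Ψ : AddSubgroup (geomTorsion W ((3 : ℕ) : ℤ)), IsRationalLine W 3 Ψ → ¬ LineDecompositionTrivialAt W 3 Ψ)
    (K : Type) [Field K] [NumberField K] (hK : IsImaginaryQuadratic K)
    (hCD2 : groupCdLE_two_galoisGroupUnramifiedOutside K)
    (hH : SatisfiesHeegnerHypothesis (W.conductorNorm ℤ) K)
    (ι : K →+* ℚ_[3]) (v vbar : HeightOneSpectrum (𝓞 K))
    (hv : ∀ x : 𝓞 K, x ∈ v.asIdeal ↔ ‖ι (x : K)‖ < 1)
    (hvbar : ((3 : ℕ) : 𝓞 K) ∈ vbar.asIdeal) (hne : vbar ≠ v)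
    (κ : ZpExtension K 3) (hκ : κ.IsAnticyclotomic)
    (γ : absoluteGaloisGroup K) [Fact (κ.IsTopGenerator γ)]
    (θsub θquot : FramedGaloisRep K (padicCoeffIntegers (∅ : Set (PadicAlgCl 3))) 1)
    (hpair : IsResidualPairOver (W.baseChange K) 3 θsub θquot)
    (Sf : Finset (HeightOneSpectrum (𝓞 K)))
    (hSf : ∀ w : HeightOneSpectrum (𝓞 K), w ∈ Sf ↔
      (((W.conductorNorm ℤ : ℤ) : 𝓞 K) ∈ w.asIdeal ∧ ((3 : ℕ) : 𝓞 K) ∉ w.asIdeal))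
    (DSsub : DatumDualData κ γ (charModule ∅ θsub)
        (AcSelmer.bdpData (charModule ∅ θsub) 3 vbar) (↑Sf : Set (HeightOneSpectrum (𝓞 K))))
    (DSquot : DatumDualData κ γ (charModule ∅ θquot)
        (AcSelmer.bdpData (charModule ∅ θquot) 3 vbar) (↑Sf : Set (HeightOneSpectrum (𝓞 K))))
    (hfgS : Module.Finite (IwasawaAlgebra 3) (AcSelmer.XAc (W.baseChange K) 3 κ vbar (↑Sf : Set (HeightOneSpectrum (𝓞 K))) γ))
    (htorS : Module.IsTorsion (IwasawaAlgebra 3) (AcSelmer.XAc (W.baseChange K) 3 κ vbar (↑Sf : Set (HeightOneSpectrum (𝓞 K))) γ))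
    (hμS : muInvariant 3 (AcSelmer.XAc (W.baseChange K) 3 κ vbar (↑Sf : Set (HeightOneSpectrum (𝓞 K))) γ) = 0)
    (hSsub : ∀ D : DatumDualData κ γ (charModule ∅ θsub)
        (AcSelmer.bdpData (charModule ∅ θsub) 3 vbar) (↑Sf : Set (HeightOneSpectrum (𝓞 K))),
      Module.Finite (IwasawaAlgebra 3) D.X ∧ Module.IsTorsion (IwasawaAlgebra 3) D.X ∧ muInvariant 3 D.X = 0)
    (hSquot : ∀ D : DatumDualData κ γ (charModule ∅ θquot)
        (AcSelmer.bdpData (charModule ∅ θquot) 3 vbar) (↑Sf : Set (HeightOneSpectrum (𝓞 K))),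
      Module.Finite (IwasawaAlgebra 3) D.X ∧ Module.IsTorsion (IwasawaAlgebra 3) D.X ∧ muInvariant 3 D.X = 0) :
    lambdaInvariant 3 DSsub.X + lambdaInvariant 3 DSquot.X ≤
      lambdaInvariant 3 (AcSelmer.XAc (W.baseChange K) 3 κ vbar (↑Sf : Set (HeightOneSpectrum (𝓞 K))) γ) +
        (if ∀ σ : absoluteGaloisGroup K, θquot σ = 1 then 1 else 0) := by
  have h32' : (3 : ℕ) ≠ 2 := by decide
  have hpvK : ((3 : ℕ) : 𝓞 K) ∈ v.asIdeal := IndexPlumbingNrVsStrict.natCast_mem_asIdeal_of_forall_norm_iff hv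
  have haddv : Addv W 3 := hX.2
  -- `3` split in `K` (Heegner for `N_W`, `3 ∣ N_W`)
  have hpN : 3 ∣ W.conductorNorm ℤ := (W.dvd_conductorNorm_iff_not_hasGoodReductionAtPrime 3).mpr haddv.1
  have hsplit : X11b.SplitsIn K 3 := splitsIn_of_satisfiesHeegnerHypothesis rfl hH hpN
  -- orientation and `W(K)[3] = 0` from the normalisation (FILE 8b)
  have hram : ∃ τ ∈ decomp vbar, unitChar θsub τ ≠ 1 :=
    AnomalousTwistOrientation.exists_mem_decomp_unitChar_ne_one_of_anomalousTwist_of_normalised rfl hV ha C hC hnorm hX.1 hK hpvK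
      hvbar hne hpair
  have htor : ∀ Q : (W.baseChange K).toAffine.Point, 3 • Q = 0 → Q = 0 :=
    AnomalousTwistOrientation.forall_baseChange_nsmul_eq_zero_of_anomalousTwist_of_normalised rfl hV ha C hC hnorm hX.1 hK hpvK hvbar hne
  -- Fin_v: the door's CLOSED crux r5 (19546)
  have hfinED : Finite {x : ↥((W.baseChange K).geomPrimaryTorsion 3) // ∀ g : ↥(κ.kerSubgroup ⊓ decomp vbar), g • x = x} := by
    have hfin := localTowerTorsionFiniteX3_proof W 3 hr h32' hX (Or.inr hSG) K hK hsplit κ hκ vbar hvbar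
    haveI := hfin.to_subtype
    refine Finite.of_injective (fun x ↦ (⟨x.1, (FixedPoints.mem_addSubgroup _ _ _).mpr fun g ↦
      x.2 ⟨g.1, Subgroup.mem_inf.mpr (Subgroup.mem_inf.mp g.2).symm⟩⟩ :
        ↥(FixedPoints.addSubgroup ↥(decomp vbar ⊓ κ.kerSubgroup) ((W.baseChange K).geomPrimaryTorsion 3)))) fun a b hab ↦ ?_
    have h := congrArg Subtype.val hab
    exact Subtype.ext h
  exact AnomalousTwistLambdaLEOffP.lambdaInvariant_add_le_of_anomalousTwist_offP h263 h41 h42 h5A h32 W 3 rfl hV ha C hC haddv K hK hCD2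
    hH htor ι v vbar hv hvbar hne κ hκ γ θsub θquot hpair hram hfinED Sf hSf DSsub DSquot hfgS htorS hμS hSsub hSquot

end Summit.BirchSwinnertonDyer.BirchSwinnertonDyer.Theorems.SchneiderFreeAdditiveX3.AnomalousTwistLambdaLEDoor

end
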